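import Literature.NumberTheory.Transcendental.DolbeaultProofs
import Literature.NumberTheory.Transcendental.ComplexFormsSmoothProofs
import HarnessLib

/-!
# `d = ∂ + ∂̄` on a complex manifold (integrability of the complex structure) — proofs

Trunk **T-KAEHLER** (`NumberTheory/Transcendental`). Theorems-only companion of
`Literature/NumberTheory/Transcendental/Dolbeault.lean`, discharging its named facts on the
integrability of the complex structure and its consequences

| named fact of `Dolbeault.lean`                                                        | discharged by                                      |
|----------------------------------------------------------------------------------------|----------------------------------------------------|
| `Literature.NumberTheory.Transcendental.mextDeriv_eq_dolbeault_add_dolbeaultBar`      | `mextDeriv_eq_dolbeault_add_dolbeaultBar_holds`    |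
| `Literature.NumberTheory.Transcendental.dolbeault_dolbeault`                          | `dolbeault_dolbeault_holds`                        |
| `Literature.NumberTheory.Transcendental.dolbeaultBar_dolbeaultBar`                    | `dolbeaultBar_dolbeaultBar_holds`                  |
| `Literature.NumberTheory.Transcendental.dolbeault_dolbeaultBar_add_dolbeaultBar_dolbeault` | `dolbeault_dolbeaultBar_add_dolbeaultBar_dolbeault_holds` |

**`d = ∂ + ∂̄`**: on a complex manifold `M` (holomorphic atlas) the exterior derivative of a
smooth form of type `(p,q)` has only components of types `(p+1,q)` and `(p,q+1)`
(`IsSmoothForm.mextDeriv_eq_of_isOfType`), so that for every smooth `k`-form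
`dα = ∑_{p+q=k} d(α^{p,q}) = ∂α + ∂̄α` with `∂α = ∑ (dα^{p,q})^{p+1,q}`, `∂̄α = ∑ (dα^{p,q})^{p,q+1}`
(Voisin (2002), §2.3.1, Def. 2.27 and the display before it: "`dα ∈ A^{p+1,q} ⊕ A^{p,q+1}` for
`α ∈ A^{p,q}`, since in holomorphic coordinates `d(f dz_I ∧ dz̄_J) = ∑ ∂f/∂zᵢ dzᵢ ∧ … +
∑ ∂f/∂z̄ᵢ dz̄ᵢ ∧ …`"; Prop. 2.31 is the converse, integrability from `d = ∂ + ∂̄`;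
Griffiths–Harris (1978), p. 24; Huybrechts (2005), Prop. 2.6.15).

## Proof (coordinate-free form of Voisin's computation)

Fix `x`, a smooth form `β` of type `(p,q)` and vectors `v₀, …, v_k`.  In the chart at `x` the
representative `φ = β.inChart x` takes, on the whole chart target, values in the alternating maps
of type `(p,q)` on the model space `E` (`IsOfType.inChart_apply_tangentRotate`: the derivative of
the inverse chart is a holomorphic, i.e. `ℂ`-linear, tangent coordinate change, which commutes
with `e^{iθ}` — `tangentCoordChange_tangentRotate`).  By Mathlib's formula
`dφ(c)(u₀,…,u_k) = ∑ᵢ (-1)ⁱ D_{uᵢ}(φ(·)(u₀,…,ûᵢ,…,u_k))(c)` (`extDerivWithin_apply`) and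
`d β x = dφ (c)` (`mextDeriv_eq_extDerivWithin`), rotating all vectors by `e^{iθ}` multiplies the
evaluated functions by `e^{i(p-q)θ}` near `c` — hence also their derivatives — while the direction
`e^{iθ}vᵢ = cos θ · vᵢ + sin θ · (ivᵢ)` enters `ℝ`-linearly; so
`dβ_x(e^{iθ}v) = e^{i(p-q)θ}(cos θ · X + sin θ · Y)` (`IsOfType.mextDeriv_apply_comp_tangentRotate`)
is a trigonometric polynomial with the two frequencies `p - q ± 1` only.  The weight components of
`dβ` being its Fourier coefficients (`MForm.weightComponent_apply_eq_coeff` of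
`ComplexFormsProofs.lean`), every type component of `dβ` other than `(p+1,q)` (weight `p-q+1`) and
`(p,q+1)` (weight `p-q-1`) vanishes (`IsOfType.typeComponent_mextDeriv_eq_zero`), and
`dβ = ∑_{r+s=k+1} (dβ)^{r,s}` (`sum_antidiagonal_typeComponent_holds`) reduces to the two terms.
For a general smooth `α`, decompose `α = ∑ α^{p,q}` (smooth summands,
`isSmoothForm_typeComponent_holds`) and use additivity of `d` on smooth forms.  Finally
`0 = d² α = d(∂α + ∂̄α) = ∂²α + (∂̄∂ + ∂∂̄)α + ∂̄²α` with the three groups of distinct types on a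
pure-type `α`, whence `∂² = 0`, `∂̄² = 0`, `∂∂̄ + ∂̄∂ = 0` (`dolbeault_dolbeault_and_of_isOfType`;
Voisin (2002), §2.3.1 after Def. 2.27), using `d ∘ d = 0` unconditionally
(`IsSmoothForm.mextDeriv_mextDeriv`, from the discharged `inChart_mextDeriv_holds`).

## References

* C. Voisin, *Hodge Theory and Complex Algebraic Geometry I* (2002), §2.3.1, Def. 2.27 (p. 54),
  Prop. 2.31. [Voisin2002]
* P. Griffiths, J. Harris, *Principles of Algebraic Geometry* (1978), p. 24.
* D. Huybrechts, *Complex Geometry* (2005), Prop. 2.6.15.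
-/

noncomputable section

open scoped Manifold ContDiff Topology
open Bundle Set Finset

namespace Literature.NumberTheory.Transcendental

variable {E : Type*} [NormedAddCommGroup E] [NormedSpace ℂ E]
  {M : Type*} [TopologicalSpace M] [ChartedSpace E M] {k : ℕ}

/-! ### Sums of forms (bookkeeping) -/

/-- Type components of a finite sum of forms (from `MForm.typeComponent_add`). [folklore] -/
theorem _root_.Literature.Geometry.Kaehler.MForm.typeComponent_sum {ι : Type*} (s : Finset ι)
    (f : ι → Literature.Geometry.Kaehler.MForm 𝓘(ℝ, E) M ℂ k) (p q : ℕ) :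
    (∑ i ∈ s, f i).typeComponent p q = ∑ i ∈ s, (f i).typeComponent p q := by
  classical
  induction s using Finset.induction_on with
  | empty => simp
  | insert a s ha ih =>
    rw [sum_insert ha, sum_insert ha, Literature.Geometry.Kaehler.MForm.typeComponent_add, ih]

/-- Type components of the negative of a form (from `MForm.typeComponent_smul`). [folklore] -/
theorem _root_.Literature.Geometry.Kaehler.MForm.typeComponent_neg
    (α : Literature.Geometry.Kaehler.MForm 𝓘(ℝ, E) M ℂ k) (p q : ℕ) :
    (-α).typeComponent p q = -α.typeComponent p q := by
  rw [← neg_one_smul ℂ α, Literature.Geometry.Kaehler.MForm.typeComponent_smul, neg_one_smul]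

/-- Type components of a difference of forms. [folklore] -/
theorem _root_.Literature.Geometry.Kaehler.MForm.typeComponent_sub
    (α β : Literature.Geometry.Kaehler.MForm 𝓘(ℝ, E) M ℂ k) (p q : ℕ) :
    (α - β).typeComponent p q = α.typeComponent p q - β.typeComponent p q := by
  rw [sub_eq_add_neg, Literature.Geometry.Kaehler.MForm.typeComponent_add,
    Literature.Geometry.Kaehler.MForm.typeComponent_neg, ← sub_eq_add_neg]

/-- The exterior derivative of a finite sum of smooth forms is the sum of the exterior
derivatives (from `mextDeriv_add`; smooth forms form a submodule). [folklore] -/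
theorem mextDeriv_sum {ι : Type*} (s : Finset ι)
    (f : ι → Literature.Geometry.Kaehler.MForm 𝓘(ℝ, E) M ℂ k)
    (hf : ∀ i ∈ s, Literature.Geometry.Kaehler.IsSmoothForm (f i)) :
    Literature.Geometry.Kaehler.mextDeriv (∑ i ∈ s, f i) =
      ∑ i ∈ s, Literature.Geometry.Kaehler.mextDeriv (f i) := by
  classical
  induction s using Finset.induction_on with
  | empty => simp [Literature.Geometry.Kaehler.mextDeriv_zero]
  | insert a s ha ih =>
    have hs : ∀ i ∈ s, Literature.Geometry.Kaehler.IsSmoothForm (f i) :=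
      fun i hi ↦ hf i (mem_insert_of_mem hi)
    have hsum : Literature.Geometry.Kaehler.IsSmoothForm (∑ i ∈ s, f i) :=
      (Literature.Geometry.Kaehler.smoothForms 𝓘(ℝ, E) M ℂ k).sum_mem fun i hi ↦ hs i hi
    rw [sum_insert ha, sum_insert ha,
      Literature.Geometry.Kaehler.mextDeriv_add (hf a (mem_insert_self a s)) hsum, ih hs]

/-! ### Smoothness of `dα` and `d ∘ d = 0`, unconditionally -/

section Real

variable {E' : Type*} [NormedAddCommGroup E'] [NormedSpace ℝ E'] {H : Type*} [TopologicalSpace H]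
  {I : ModelWithCorners ℝ E' H} {N : Type*} [TopologicalSpace N] [ChartedSpace H N]
  [IsManifold I ∞ N] {F : Type*} [NormedAddCommGroup F] [NormedSpace ℝ F] {n : ℕ}

/-- **The exterior derivative of a smooth form is smooth**, unconditionally: G21's
`isSmoothForm_mextDeriv` fed with the discharged chart-independence fact `inChart_mextDeriv_holds`
(`ManifoldFormsChart`). Warner (1983), Thm. 2.20. [cite: Warner1983, Thm. 2.20] -/
theorem _root_.Literature.Geometry.Kaehler.IsSmoothForm.mextDeriv
    {α : Literature.Geometry.Kaehler.MForm I N F n} (hα : Literature.Geometry.Kaehler.IsSmoothForm α) :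
    Literature.Geometry.Kaehler.IsSmoothForm (Literature.Geometry.Kaehler.mextDeriv α) :=
  Literature.Geometry.Kaehler.isSmoothForm_mextDeriv
    (Literature.Geometry.Kaehler.inChart_mextDeriv_holds I N F) hα

/-- **`d ∘ d = 0` on smooth forms**, unconditionally: G21's `mextDeriv_mextDeriv` fed with the
discharged `inChart_mextDeriv_holds`. Warner (1983), Thm. 2.20(3). [cite: Warner1983, Thm. 2.20] -/
theorem _root_.Literature.Geometry.Kaehler.IsSmoothForm.mextDeriv_mextDeriv
    {α : Literature.Geometry.Kaehler.MForm I N F n} (hα : Literature.Geometry.Kaehler.IsSmoothForm α) :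
    Literature.Geometry.Kaehler.mextDeriv (Literature.Geometry.Kaehler.mextDeriv α) = 0 :=
  Literature.Geometry.Kaehler.mextDeriv_mextDeriv
    (Literature.Geometry.Kaehler.inChart_mextDeriv_holds I N F) hα

end Real

/-! ### The derivative of a form of pure type along a rotating frame -/

section Holomorphic

variable [IsManifold 𝓘(ℂ, E) ω M] [IsManifold 𝓘(ℝ, E) ∞ M]

/-- **Chart representatives of a `(p,q)`-form have type `(p,q)` on the whole chart.** For a form
`β` of type `(p,q)` and a point `y` of the target of the chart at `x`,
`(β.inChart x y)(e^{iθ}u) = e^{i(p-q)θ} (β.inChart x y)(u)`: the representative is `β z ∘ T` with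
`T` the tangent coordinate change at `z = (extChartAt x)⁻¹ y` (`MForm.inChart_eq_of_mem_target`),
and `T` commutes with `e^{iθ}` on a complex manifold (`tangentCoordChange_tangentRotate`).
Voisin (2002), §2.2.1, §2.3.1. [cite: Voisin2002, §2.3.1] -/
theorem IsOfType.inChart_apply_tangentRotate {p q : ℕ}
    {β : Literature.Geometry.Kaehler.MForm 𝓘(ℝ, E) M ℂ k} (hβ : IsOfType p q β) (x : M) {y : E}
    (hy : y ∈ (extChartAt 𝓘(ℝ, E) x).target) (θ : ℝ) (u : Fin k → E) :
    β.inChart x y (fun i ↦ tangentRotate E x θ (u i)) =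
      Complex.exp ((((p : ℤ) - q : ℤ) : ℂ) * θ * Complex.I) * β.inChart x y u := by
  have hz : (extChartAt 𝓘(ℝ, E) x).symm y ∈ (extChartAt 𝓘(ℝ, E) x).source :=
    (extChartAt 𝓘(ℝ, E) x).map_target hy
  rw [β.inChart_eq_of_mem_target hy]
  simp only [ContinuousAlternatingMap.compContinuousLinearMap_apply, Function.comp_def]
  have key := hβ.2 ((extChartAt 𝓘(ℝ, E) x).symm y) θ
    (fun i ↦ tangentCoordChange 𝓘(ℝ, E) x ((extChartAt 𝓘(ℝ, E) x).symm y)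
      ((extChartAt 𝓘(ℝ, E) x).symm y) (u i))
  simp only [← tangentCoordChange_tangentRotate hz] at key
  exact key

/-- **The exterior derivative of a `(p,q)`-form along a rotating frame.** For a smooth form `β`
of type `(p,q)`, a point `x` and vectors `v₀, …, v_k`, there are `X, Y ∈ ℂ` with
`dβ_x(e^{iθ}v₀, …, e^{iθ}v_k) = e^{i(p-q)θ} (cos θ · X + sin θ · Y)` for all real `θ`: by
`extDerivWithin_apply`, `dβ_x(u) = ∑ᵢ (-1)ⁱ D_{uᵢ}(φ(·)(û))`, where rotating the evaluated
vectors multiplies `φ(·)(û)` by `e^{i(p-q)θ}` near the centre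
(`IsOfType.inChart_apply_tangentRotate`), hence also its derivative, and the direction
`e^{iθ}vᵢ = cos θ · vᵢ + sin θ · ivᵢ` enters `ℝ`-linearly.  This is the computation
"`d(A^{p,q}) ⊆ A^{p+1,q} ⊕ A^{p,q+1}`" of Voisin (2002), §2.3.1 (before Def. 2.27) in invariant
form. [cite: Voisin2002, §2.3.1 Def. 2.27] -/
theorem IsOfType.mextDeriv_apply_comp_tangentRotate {p q : ℕ}
    {β : Literature.Geometry.Kaehler.MForm 𝓘(ℝ, E) M ℂ k}
    (hβs : Literature.Geometry.Kaehler.IsSmoothForm β) (hβ : IsOfType p q β) (x : M)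
    (v : Fin (k + 1) → TangentSpace 𝓘(ℝ, E) x) :
    ∃ X Y : ℂ, ∀ θ : ℝ,
      Literature.Geometry.Kaehler.mextDeriv β x (⇑(tangentRotate E x θ) ∘ v) =
        Complex.exp ((((p : ℤ) - q : ℤ) : ℂ) * θ * Complex.I) *
          ((Real.cos θ : ℂ) * X + (Real.sin θ : ℂ) * Y) := by
  set c : E := extChartAt 𝓘(ℝ, E) x x with hc
  set φ : E → E [⋀^Fin k]→L[ℝ] ℂ := β.inChart x with hφdef
  have hU : UniqueDiffWithinAt ℝ (range 𝓘(ℝ, E)) c :=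
    (𝓘(ℝ, E)).uniqueDiffOn _ (extChartAt_target_subset_range x (mem_extChartAt_target x))
  have hφ : DifferentiableWithinAt ℝ φ (range 𝓘(ℝ, E)) c :=
    (hβs x).differentiableWithinAt (by simp)
  -- the vectors, read in the model space `E = T_x M`
  set v' : Fin (k + 1) → E := fun i ↦ (show E from v i) with hv'
  -- the scalar derivatives of the evaluated representative, `Dᵢ = D(φ(·)(v₀,…,v̂ᵢ,…,v_k))(c)`
  set D : Fin (k + 1) → E →L[ℝ] ℂ := fun i ↦
    fderivWithin ℝ (fun y ↦ φ y (i.removeNth v')) (range 𝓘(ℝ, E)) c with hD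
  refine ⟨∑ i : Fin (k + 1), (-1 : ℂ) ^ (i : ℕ) * D i (v' i),
    ∑ i : Fin (k + 1), (-1 : ℂ) ^ (i : ℕ) * D i (Complex.I • v' i), fun θ ↦ ?_⟩
  set e : ℂ := Complex.exp ((((p : ℤ) - q : ℤ) : ℂ) * θ * Complex.I) with he
  -- the rotated vectors, read in `E`
  set w : Fin (k + 1) → E := fun i ↦ Complex.exp (θ * Complex.I) • v' i with hw
  rw [Literature.Geometry.Kaehler.mextDeriv_eq_extDerivWithin]
  change extDerivWithin φ (range 𝓘(ℝ, E)) c w = _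
  rw [extDerivWithin_apply hφ hU]
  -- rotating the evaluated vectors multiplies the evaluated representative by `e` near `c`
  have key : ∀ i : Fin (k + 1),
      fderivWithin ℝ (fun y ↦ φ y (i.removeNth w)) (range 𝓘(ℝ, E)) c = e • D i := by
    intro i
    have hev : (fun y ↦ φ y (i.removeNth w)) =ᶠ[𝓝[range 𝓘(ℝ, E)] c]
        e • fun y ↦ φ y (i.removeNth v') := by
      filter_upwards [extChartAt_target_mem_nhdsWithin (I := 𝓘(ℝ, E)) x] with y hy
      exact hβ.inChart_apply_tangentRotate x hy θ (i.removeNth v')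
    rw [hev.fderivWithin_eq (hev.self_of_nhdsWithin
      (extChartAt_target_subset_range x (mem_extChartAt_target x)))]
    exact fderivWithin_const_smul_field e hU
  -- the direction `e^{iθ} vᵢ = cos θ • vᵢ + sin θ • (i vᵢ)` enters `ℝ`-linearly
  have hdir : ∀ i : Fin (k + 1), (e • D i) (w i) =
      e * ((Real.cos θ : ℂ) * D i (v' i) + (Real.sin θ : ℂ) * D i (Complex.I • v' i)) := by
    intro i
    rw [show (e • D i) (w i) = e * D i (w i) from rfl,
      show w i = _ from exp_mul_I_smul_eq θ (v' i),
      map_add, (D i).map_smul, (D i).map_smul, Complex.real_smul, Complex.real_smul]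
  simp_rw [key, hdir]
  simp only [Finset.mul_sum, mul_add]
  rw [← Finset.sum_add_distrib]
  refine Finset.sum_congr rfl fun i _ ↦ ?_
  rw [zsmul_eq_mul]
  push_cast
  ring

/-- With `X, Y` as in `IsOfType.mextDeriv_apply_comp_tangentRotate`, the trigonometric polynomial
`e^{idθ}(cos θ · X + sin θ · Y)` is the value at `e^{iθ}` of the two-term Laurent polynomial
`a T^{d+1} + b T^{d-1}`, `a = (X - iY)/2`, `b = (X + iY)/2` (Euler's formulas; the spelling of the
Fourier sum is that of `MForm.weightComponent_apply_eq_coeff`). [folklore] -/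
theorem exp_mul_cos_add_sin_eq_sum_coeff (d : ℤ) (X Y : ℂ) :
    let P : LaurentPolynomial ℂ :=
      AddMonoidAlgebra.single (d + 1) ((X - Complex.I * Y) / 2) +
        AddMonoidAlgebra.single (d - 1) ((X + Complex.I * Y) / 2)
    P.coeff.support ⊆ {d + 1, d - 1} ∧
      ∀ θ : ℝ, Complex.exp ((d : ℂ) * θ * Complex.I) * ((Real.cos θ : ℂ) * X + (Real.sin θ : ℂ) * Y) =
        ∑ m ∈ P.coeff.support, P.coeff m * Complex.exp (m * θ * Complex.I) := by
  intro P
  refine ⟨?_, fun θ ↦ ?_⟩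
  · rw [AddMonoidAlgebra.coeff_add]
    refine Finsupp.support_add.trans (Finset.union_subset ?_ ?_)
    · exact Finsupp.support_single_subset.trans (by simp)
    · exact Finsupp.support_single_subset.trans (by simp)
  · rw [← eval₂_expUnit_eq_sum, map_add, eval₂_expUnit_single, eval₂_expUnit_single]
    have e1 : Complex.exp (((d + 1 : ℤ) : ℂ) * θ * Complex.I) =
        Complex.exp ((d : ℂ) * θ * Complex.I) * Complex.exp ((θ : ℂ) * Complex.I) := by
      rw [← Complex.exp_add]; congr 1; push_cast; ring
    have e2 : Complex.exp (((d - 1 : ℤ) : ℂ) * θ * Complex.I) =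
        Complex.exp ((d : ℂ) * θ * Complex.I) * Complex.exp (-(θ : ℂ) * Complex.I) := by
      rw [← Complex.exp_add]; congr 1; push_cast; ring
    rw [e1, e2, Complex.ofReal_cos, Complex.ofReal_sin, Complex.cos, Complex.sin]
    ring

/-- **The exterior derivative of a `(p,q)`-form has no components of type other than `(p+1,q)`
and `(p,q+1)`** (complex manifold; Voisin (2002), §2.3.1, before Def. 2.27:
`d A^{p,q} ⊆ A^{p+1,q} ⊕ A^{p,q+1}`): by `IsOfType.mextDeriv_apply_comp_tangentRotate` and Euler's
formulas, `θ ↦ dβ_x(e^{iθ}v)` has the two frequencies `p - q ± 1` only, and the weight components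
of `dβ` are its Fourier coefficients (`MForm.weightComponent_apply_eq_coeff`).
[cite: Voisin2002, §2.3.1 Def. 2.27] -/
theorem IsOfType.typeComponent_mextDeriv_eq_zero {p q r s : ℕ}
    {β : Literature.Geometry.Kaehler.MForm 𝓘(ℝ, E) M ℂ k}
    (hβs : Literature.Geometry.Kaehler.IsSmoothForm β) (hβ : IsOfType p q β)
    (hne₁ : (r, s) ≠ (p + 1, q)) (hne₂ : (r, s) ≠ (p, q + 1)) :
    (Literature.Geometry.Kaehler.mextDeriv β).typeComponent r s = 0 := by
  by_cases hrs : r + s = k + 1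
  swap
  · exact Literature.Geometry.Kaehler.MForm.typeComponent_of_ne hrs _
  have hpq : p + q = k := hβ.1
  rw [Literature.Geometry.Kaehler.MForm.typeComponent, if_pos hrs]
  funext x
  ext v
  obtain ⟨X, Y, hXY⟩ := hβ.mextDeriv_apply_comp_tangentRotate hβs x v
  obtain ⟨hsupp, hev⟩ := exp_mul_cos_add_sin_eq_sum_coeff ((p : ℤ) - q) X Y
  set P : LaurentPolynomial ℂ :=
    AddMonoidAlgebra.single ((p : ℤ) - q + 1) ((X - Complex.I * Y) / 2) +
      AddMonoidAlgebra.single ((p : ℤ) - q - 1) ((X + Complex.I * Y) / 2) with hPdef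
  have hP : ∀ m ∈ P.coeff.support, m.natAbs ≤ k + 1 ∧ (2 : ℤ) ∣ m + (k + 1 : ℕ) := by
    intro m hm
    have h := hsupp hm
    simp only [Finset.mem_insert, Finset.mem_singleton] at h
    push_cast
    rcases h with rfl | rfl <;> constructor <;> omega
  have hPev : ∀ θ : ℝ, Literature.Geometry.Kaehler.mextDeriv β x (⇑(tangentRotate E x θ) ∘ v) =
      ∑ m ∈ P.coeff.support, P.coeff m * Complex.exp (m * θ * Complex.I) := fun θ ↦ by
    rw [hXY θ, hev θ]
  rw [(Literature.Geometry.Kaehler.mextDeriv β).weightComponent_apply_eq_coeff x v hP hPev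
    (w := (r : ℤ) - s) (by omega)]
  have hnot : ((r : ℤ) - s) ∉ P.coeff.support := fun h ↦ by
    have h' := hsupp h
    simp only [Finset.mem_insert, Finset.mem_singleton] at h'
    rcases h' with h' | h'
    · exact hne₁ (Prod.ext (by simp; omega) (by simp; omega))
    · exact hne₂ (Prod.ext (by simp; omega) (by simp; omega))
  rw [Finsupp.notMem_support_iff.mp hnot]
  rfl

/-- **`dβ = (dβ)^{p+1,q} + (dβ)^{p,q+1}` for a smooth form `β` of type `(p,q)`** on a complex
manifold: the type decomposition `dβ = ∑_{r+s=k+1} (dβ)^{r,s}`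
(`sum_antidiagonal_typeComponent_holds`) has only these two nonzero terms
(`IsOfType.typeComponent_mextDeriv_eq_zero`). Voisin (2002), §2.3.1, before Def. 2.27.
[cite: Voisin2002, §2.3.1 Def. 2.27] -/
theorem _root_.Literature.Geometry.Kaehler.IsSmoothForm.mextDeriv_eq_typeComponent_add {p q : ℕ}
    {β : Literature.Geometry.Kaehler.MForm 𝓘(ℝ, E) M ℂ k}
    (hβs : Literature.Geometry.Kaehler.IsSmoothForm β) (hβ : IsOfType p q β) :
    Literature.Geometry.Kaehler.mextDeriv β =
      (Literature.Geometry.Kaehler.mextDeriv β).typeComponent (p + 1) q +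
        (Literature.Geometry.Kaehler.mextDeriv β).typeComponent p (q + 1) := by
  have hpq : p + q = k := hβ.1
  conv_lhs => rw [← sum_antidiagonal_typeComponent_holds (Literature.Geometry.Kaehler.mextDeriv β)]
  have hsub : ({(p + 1, q), (p, q + 1)} : Finset (ℕ × ℕ)) ⊆ antidiagonal (k + 1) := by
    intro rs hrs
    simp only [Finset.mem_insert, Finset.mem_singleton] at hrs
    rw [mem_antidiagonal]
    rcases hrs with rfl | rfl <;> omega
  rw [← Finset.sum_subset hsub, Finset.sum_pair]
  · simp
  · intro rs _ hnot
    simp only [Finset.mem_insert, Finset.mem_singleton, not_or] at hnot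
    obtain ⟨r, s⟩ := rs
    exact hβ.typeComponent_mextDeriv_eq_zero hβs hnot.1 hnot.2

/-- Discharge of the named fact `Literature.NumberTheory.Transcendental.mextDeriv_eq_dolbeault_add_dolbeaultBar`:
**`d = ∂ + ∂̄` on a complex manifold** — for a smooth complex `k`-form `α`,
`dα = ∑_{p+q=k} d(α^{p,q})` (`d` additive on the smooth summands `α^{p,q}`,
`isSmoothForm_typeComponent_holds`) and `d(α^{p,q}) = (dα^{p,q})^{p+1,q} + (dα^{p,q})^{p,q+1}`
(`IsSmoothForm.mextDeriv_eq_typeComponent_add`), which are the summands of `∂α + ∂̄α`.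
Voisin (2002), §2.3.1, Def. 2.27 (p. 54) and Prop. 2.31; Griffiths–Harris (1978), p. 24;
Huybrechts (2005), Prop. 2.6.15. [cite: Voisin2002, §2.3.1 Def. 2.27] -/
theorem mextDeriv_eq_dolbeault_add_dolbeaultBar_holds :
    mextDeriv_eq_dolbeault_add_dolbeaultBar (E := E) (M := M) (k := k) := by
  intro α hα
  have hsm : ∀ pq ∈ antidiagonal k,
      Literature.Geometry.Kaehler.IsSmoothForm (α.typeComponent pq.1 pq.2) :=
    fun pq _ ↦ isSmoothForm_typeComponent_holds _ _ hα
  conv_lhs => rw [← sum_antidiagonal_typeComponent_holds α]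
  rw [mextDeriv_sum _ _ hsm, dolbeault, dolbeaultBar, ← Finset.sum_add_distrib]
  refine Finset.sum_congr rfl fun pq hpq ↦ ?_
  exact (hsm pq hpq).mextDeriv_eq_typeComponent_add
    (isOfType_typeComponent_holds (mem_antidiagonal.mp hpq) α)

/-! ### Consequences: `∂² = 0`, `∂̄² = 0`, `∂∂̄ + ∂̄∂ = 0` -/

/-- `∂̄` of a finite sum of smooth forms (from `dolbeaultBar_add` with the discharged
`isSmoothForm_typeComponent_holds`). [folklore] -/
theorem dolbeaultBar_sum {ι : Type*} (s : Finset ι)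
    (f : ι → Literature.Geometry.Kaehler.MForm 𝓘(ℝ, E) M ℂ k)
    (hf : ∀ i ∈ s, Literature.Geometry.Kaehler.IsSmoothForm (f i)) :
    dolbeaultBar (∑ i ∈ s, f i) = ∑ i ∈ s, dolbeaultBar (f i) := by
  classical
  induction s using Finset.induction_on with
  | empty => simp
  | insert a s ha ih =>
    have hs : ∀ i ∈ s, Literature.Geometry.Kaehler.IsSmoothForm (f i) :=
      fun i hi ↦ hf i (mem_insert_of_mem hi)
    have hsum : Literature.Geometry.Kaehler.IsSmoothForm (∑ i ∈ s, f i) :=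
      (Literature.Geometry.Kaehler.smoothForms 𝓘(ℝ, E) M ℂ k).sum_mem fun i hi ↦ hs i hi
    rw [sum_insert ha, sum_insert ha,
      dolbeaultBar_add isSmoothForm_typeComponent_holds (hf a (mem_insert_self a s)) hsum, ih hs]

/-- `∂` of a finite sum of smooth forms (from `dolbeault_add` with the discharged
`isSmoothForm_typeComponent_holds`). [folklore] -/
theorem dolbeault_sum {ι : Type*} (s : Finset ι)
    (f : ι → Literature.Geometry.Kaehler.MForm 𝓘(ℝ, E) M ℂ k)
    (hf : ∀ i ∈ s, Literature.Geometry.Kaehler.IsSmoothForm (f i)) :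
    dolbeault (∑ i ∈ s, f i) = ∑ i ∈ s, dolbeault (f i) := by
  classical
  induction s using Finset.induction_on with
  | empty => simp
  | insert a s ha ih =>
    have hs : ∀ i ∈ s, Literature.Geometry.Kaehler.IsSmoothForm (f i) :=
      fun i hi ↦ hf i (mem_insert_of_mem hi)
    have hsum : Literature.Geometry.Kaehler.IsSmoothForm (∑ i ∈ s, f i) :=
      (Literature.Geometry.Kaehler.smoothForms 𝓘(ℝ, E) M ℂ k).sum_mem fun i hi ↦ hs i hi
    rw [sum_insert ha, sum_insert ha,
      dolbeault_add isSmoothForm_typeComponent_holds (hf a (mem_insert_self a s)) hsum, ih hs]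

/-- **`∂² = 0`, `∂̄² = 0` and `∂∂̄ + ∂̄∂ = 0` on a smooth form of pure type** (complex manifold):
for `α` smooth of type `(p,q)`, `0 = d(dα) = d(∂α + ∂̄α) = ∂∂α + (∂̄∂α + ∂∂̄α) + ∂̄∂̄α` with the
three groups of the distinct types `(p+2,q)`, `(p+1,q+1)`, `(p,q+2)`, so each vanishes by the
directness of the type decomposition (`d ∘ d = 0` from `inChart_mextDeriv_holds`, `d = ∂ + ∂̄`
from `mextDeriv_eq_dolbeault_add_dolbeaultBar_holds`). Voisin (2002), §2.3.1, display after
Def. 2.27 (`∂² = ∂̄² = ∂∂̄ + ∂̄∂ = 0` from `d² = 0`); Griffiths–Harris (1978), p. 25;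
Huybrechts (2005), Cor. 2.6.18. [cite: Voisin2002, §2.3.1 Def. 2.27] -/
theorem dolbeault_dolbeault_and_of_isOfType {p q : ℕ}
    {α : Literature.Geometry.Kaehler.MForm 𝓘(ℝ, E) M ℂ k}
    (hαs : Literature.Geometry.Kaehler.IsSmoothForm α) (hα : IsOfType p q α) :
    dolbeault (dolbeault α) = 0 ∧ dolbeaultBar (dolbeaultBar α) = 0 ∧
      dolbeault (dolbeaultBar α) + dolbeaultBar (dolbeault α) = 0 := by
  -- smoothness and types of `∂α`, `∂̄α` and of the four second derivatives
  have h1s : Literature.Geometry.Kaehler.IsSmoothForm (dolbeault α) :=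
    isSmoothForm_dolbeault isSmoothForm_typeComponent_holds (fun hβ ↦ hβ.mextDeriv) hαs
  have h2s : Literature.Geometry.Kaehler.IsSmoothForm (dolbeaultBar α) :=
    isSmoothForm_dolbeaultBar isSmoothForm_typeComponent_holds (fun hβ ↦ hβ.mextDeriv) hαs
  have h1 : IsOfType (p + 1) q (dolbeault α) := IsOfType.dolbeault_holds hα
  have h2 : IsOfType p (q + 1) (dolbeaultBar α) := IsOfType.dolbeaultBar_holds hα
  have hA : IsOfType (p + 1 + 1) q (dolbeault (dolbeault α)) := IsOfType.dolbeault_holds h1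
  have hB : IsOfType (p + 1) (q + 1) (dolbeaultBar (dolbeault α)) := IsOfType.dolbeaultBar_holds h1
  have hC : IsOfType (p + 1) (q + 1) (dolbeault (dolbeaultBar α)) := IsOfType.dolbeault_holds h2
  have hD : IsOfType p (q + 1 + 1) (dolbeaultBar (dolbeaultBar α)) := IsOfType.dolbeaultBar_holds h2
  -- `0 = d(dα) = (∂∂α + ∂̄∂α) + (∂∂̄α + ∂̄∂̄α)`
  have hS : dolbeault (dolbeault α) + dolbeaultBar (dolbeault α) +
      (dolbeault (dolbeaultBar α) + dolbeaultBar (dolbeaultBar α)) = 0 := by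
    have h0 := hαs.mextDeriv_mextDeriv
    rwa [mextDeriv_eq_dolbeault_add_dolbeaultBar_holds hαs,
      Literature.Geometry.Kaehler.mextDeriv_add h1s h2s,
      mextDeriv_eq_dolbeault_add_dolbeaultBar_holds h1s,
      mextDeriv_eq_dolbeault_add_dolbeaultBar_holds h2s] at h0
  -- project `hS` to the three types
  have eA := congrArg (Literature.Geometry.Kaehler.MForm.typeComponent (p + 1 + 1) q) hS
  have eD := congrArg (Literature.Geometry.Kaehler.MForm.typeComponent p (q + 1 + 1)) hS
  have eBC := congrArg (Literature.Geometry.Kaehler.MForm.typeComponent (p + 1) (q + 1)) hS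
  simp only [Literature.Geometry.Kaehler.MForm.typeComponent_add,
    Literature.Geometry.Kaehler.MForm.typeComponent_zero,
    (isOfType_iff_typeComponent_eq_self_holds hA.add_eq _).mp hA,
    (isOfType_iff_typeComponent_eq_self_holds hB.add_eq _).mp hB,
    (isOfType_iff_typeComponent_eq_self_holds hC.add_eq _).mp hC,
    (isOfType_iff_typeComponent_eq_self_holds hD.add_eq _).mp hD,
    IsOfType.typeComponent_of_ne_holds hA (show p + 1 + 1 ≠ p + 1 ∨ q ≠ q + 1 by omega),
    IsOfType.typeComponent_of_ne_holds hA (show p + 1 + 1 ≠ p ∨ q ≠ q + 1 + 1 by omega),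
    IsOfType.typeComponent_of_ne_holds hB (show p + 1 ≠ p + 1 + 1 ∨ q + 1 ≠ q by omega),
    IsOfType.typeComponent_of_ne_holds hB (show p + 1 ≠ p ∨ q + 1 ≠ q + 1 + 1 by omega),
    IsOfType.typeComponent_of_ne_holds hC (show p + 1 ≠ p + 1 + 1 ∨ q + 1 ≠ q by omega),
    IsOfType.typeComponent_of_ne_holds hC (show p + 1 ≠ p ∨ q + 1 ≠ q + 1 + 1 by omega),
    IsOfType.typeComponent_of_ne_holds hD (show p ≠ p + 1 + 1 ∨ q + 1 + 1 ≠ q by omega),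
    IsOfType.typeComponent_of_ne_holds hD (show p ≠ p + 1 ∨ q + 1 + 1 ≠ q + 1 by omega),
    add_zero, zero_add] at eA eD eBC
  exact ⟨eA, eD, (add_comm _ _).trans eBC⟩

/-- Discharge of the named fact `Literature.NumberTheory.Transcendental.dolbeault_dolbeault`:
**`∂² = 0` on smooth forms** of a complex manifold (decompose into types, `dolbeault_sum`, and
`dolbeault_dolbeault_and_of_isOfType`). Voisin (2002), §2.3.1 (after Def. 2.27);
Griffiths–Harris (1978), p. 25; Huybrechts (2005), Cor. 2.6.18. [cite: Voisin2002, §2.3.1 Def. 2.27] -/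
theorem dolbeault_dolbeault_holds : dolbeault_dolbeault (E := E) (M := M) (k := k) := by
  intro α hα
  have hsm : ∀ pq ∈ antidiagonal k,
      Literature.Geometry.Kaehler.IsSmoothForm (α.typeComponent pq.1 pq.2) :=
    fun pq _ ↦ isSmoothForm_typeComponent_holds _ _ hα
  have hsm' : ∀ pq ∈ antidiagonal k,
      Literature.Geometry.Kaehler.IsSmoothForm (dolbeault (α.typeComponent pq.1 pq.2)) :=
    fun pq hpq ↦ isSmoothForm_dolbeault isSmoothForm_typeComponent_holds
      (fun hβ ↦ hβ.mextDeriv) (hsm pq hpq)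
  conv_lhs => rw [← sum_antidiagonal_typeComponent_holds α]
  rw [dolbeault_sum _ _ hsm, dolbeault_sum _ _ hsm']
  exact Finset.sum_eq_zero fun pq hpq ↦ (dolbeault_dolbeault_and_of_isOfType (hsm pq hpq)
    (isOfType_typeComponent_holds (mem_antidiagonal.mp hpq) α)).1

/-- Discharge of the named fact `Literature.NumberTheory.Transcendental.dolbeaultBar_dolbeaultBar`:
**`∂̄² = 0` on smooth forms** of a complex manifold — the Dolbeault complex is a complex
(decompose into types, `dolbeaultBar_sum`, and `dolbeault_dolbeault_and_of_isOfType`).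
Voisin (2002), §2.3.1 (after Def. 2.27); Griffiths–Harris (1978), p. 25; Huybrechts (2005),
Cor. 2.6.18. [cite: Voisin2002, §2.3.1 Def. 2.27] -/
theorem dolbeaultBar_dolbeaultBar_holds : dolbeaultBar_dolbeaultBar (E := E) (M := M) (k := k) := by
  intro α hα
  have hsm : ∀ pq ∈ antidiagonal k,
      Literature.Geometry.Kaehler.IsSmoothForm (α.typeComponent pq.1 pq.2) :=
    fun pq _ ↦ isSmoothForm_typeComponent_holds _ _ hα
  have hsm' : ∀ pq ∈ antidiagonal k,
      Literature.Geometry.Kaehler.IsSmoothForm (dolbeaultBar (α.typeComponent pq.1 pq.2)) :=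
    fun pq hpq ↦ isSmoothForm_dolbeaultBar isSmoothForm_typeComponent_holds
      (fun hβ ↦ hβ.mextDeriv) (hsm pq hpq)
  conv_lhs => rw [← sum_antidiagonal_typeComponent_holds α]
  rw [dolbeaultBar_sum _ _ hsm, dolbeaultBar_sum _ _ hsm']
  exact Finset.sum_eq_zero fun pq hpq ↦ (dolbeault_dolbeault_and_of_isOfType (hsm pq hpq)
    (isOfType_typeComponent_holds (mem_antidiagonal.mp hpq) α)).2.1

/-- Discharge of the named fact
`Literature.NumberTheory.Transcendental.dolbeault_dolbeaultBar_add_dolbeaultBar_dolbeault`: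
**`∂∂̄ + ∂̄∂ = 0` on smooth forms** of a complex manifold (decompose into types,
`dolbeault_sum` / `dolbeaultBar_sum`, and `dolbeault_dolbeault_and_of_isOfType`). Voisin (2002),
§2.3.1 (after Def. 2.27); Griffiths–Harris (1978), p. 25; Huybrechts (2005), Cor. 2.6.18.
[cite: Voisin2002, §2.3.1 Def. 2.27] -/
theorem dolbeault_dolbeaultBar_add_dolbeaultBar_dolbeault_holds :
    dolbeault_dolbeaultBar_add_dolbeaultBar_dolbeault (E := E) (M := M) (k := k) := by
  intro α hα
  have hsm : ∀ pq ∈ antidiagonal k,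
      Literature.Geometry.Kaehler.IsSmoothForm (α.typeComponent pq.1 pq.2) :=
    fun pq _ ↦ isSmoothForm_typeComponent_holds _ _ hα
  have hsm₁ : ∀ pq ∈ antidiagonal k,
      Literature.Geometry.Kaehler.IsSmoothForm (dolbeault (α.typeComponent pq.1 pq.2)) :=
    fun pq hpq ↦ isSmoothForm_dolbeault isSmoothForm_typeComponent_holds
      (fun hβ ↦ hβ.mextDeriv) (hsm pq hpq)
  have hsm₂ : ∀ pq ∈ antidiagonal k,
      Literature.Geometry.Kaehler.IsSmoothForm (dolbeaultBar (α.typeComponent pq.1 pq.2)) :=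
    fun pq hpq ↦ isSmoothForm_dolbeaultBar isSmoothForm_typeComponent_holds
      (fun hβ ↦ hβ.mextDeriv) (hsm pq hpq)
  conv_lhs => rw [← sum_antidiagonal_typeComponent_holds α]
  rw [dolbeaultBar_sum _ _ hsm, dolbeault_sum _ _ hsm, dolbeault_sum _ _ hsm₂,
    dolbeaultBar_sum _ _ hsm₁, ← Finset.sum_add_distrib]
  exact Finset.sum_eq_zero fun pq hpq ↦ (dolbeault_dolbeault_and_of_isOfType (hsm pq hpq)
    (isOfType_typeComponent_holds (mem_antidiagonal.mp hpq) α)).2.2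

end Holomorphic

end Literature.NumberTheory.Transcendental
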